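import Summits.Ventures.YMGap.Conjectures.StrongCouplingChiralLROReduction
import Summits.Ventures.YMGap.Conjectures.StrongCouplingChiralLROFixedVolume
import HarnessLib
import HarnessLib.Audit.Tags

/-!
# Venture YMGap — Conjectures/StrongCouplingChiralLROReductionQuantitative.lean: what a small-`β`
# extension of Salmhofer–Seiler needs, QUANTITATIVELY — the `β = 0` margin, and `ε`-semicontinuity of
# the infrared and Schwinger–Dyson constants at `β = 0⁺`, uniformly in the volume

HONEST FRAMING (venture `Summits/Ventures/YMGap`, cell `pub-ymgap`, seat qcd-lit g18, `bears_on: Q1`).  The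
conjecture `Summit.Ventures.YMGap.Conjectures.SalmhoferSeilerSmallBeta` is NOT proved here and remains open.
`StrongCouplingChiralLROReduction` reduced it to two volume-uniform inputs at small `β` — an infrared bound
(IR)_{β,A} (row S3 of the cell memo) and a Schwinger–Dyson bound (SD)_{β,b} (row S4) with `2A·S(ν) < b` —
and discharged both at `β = 0` with the printed constants `A = 4N`, `b = (2N)²/K(N)`.  This file adds:

* **`zeroCoupling_margin`** — the `β = 0` margin `2·(4N)·S(ν) < (2N)²/K(N)` for `1 ≤ N ≤ 4`, `ν ≥ 4`
  (the printed condition `2S(ν)K(N)/N < 1` of Cor. 4.9, from the tree's `S(ν) < 0.35` for `ν ≥ 4` —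
  `ComplexSpin.fluctS_lt_of_four_le`, Prop. 4.2 (4) — and `K(1..4) = 1, 2, 10/3, 83/15` —
  `ComplexSpin.sdK_uN_one` … `sdK_uN_four`);
* **`salmhoferSeilerSmallBeta_of_semicontinuous_bounds`** — `SalmhoferSeilerSmallBeta` follows as soon
  as, for every `1 ≤ N ≤ 4`, `ν ≥ 4` and every `ε > 0`, there are `β₁ > 0` and `L₀` such that for all
  `0 ≤ β < β₁` and all even `L ≥ L₀` the conjecture's kernel obeys the `β = 0` bounds up to `ε`:
  (IR)_{β, 4N+ε} and (SD)_{β, (2N)²/K(N)-ε}.  What is missing for Y3 is therefore EXACTLY the upper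
  semicontinuity of the infrared constant and the lower semicontinuity of the Schwinger–Dyson constant
  at `β = 0⁺`, UNIFORMLY IN THE VOLUME (at each fixed `L` this is automatic from the real-analyticity in
  `β`, `StrongCouplingChiralLROAnalyticCoupling`; the uniformity is the open content — not in print);
* **`semicontinuous_bounds_fixedVolume`** — the fixed-volume statement just mentioned, as a theorem: for
  `1 ≤ N ≤ 4`, every even torus and every `ε > 0` there is `β₁(ε, L) > 0` with (IR)_{β,4N+ε} and
  (SD)_{β,(2N)²/K(N)-ε} for all `0 ≤ β < β₁` (continuity of the kernel in `β`,
  `continuous_ssTwoPoint_massless`, finitely many characters, and the `β = 0` theorems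
  `infraredBound_zero`, `schwingerDysonBound_zero`).  So the hypothesis of
  `salmhoferSeilerSmallBeta_of_semicontinuous_bounds` fails, if at all, ONLY through the dependence of
  `β₁` on `L`.

WHAT THIS IS NOT: no bound at any `β > 0`; nothing about `SU(N)`, Wilson fermions, the continuum,
`IsChiralAtZero`, a mass gap, or the Clay problem.  Theorems only; no facts, no `sorry`.

References: M. Salmhofer, E. Seiler, Commun. Math. Phys. 139 (1991) 395–432, Prop. 4.2 (4), Thm. 4.8
(4.40)–(4.42), Cor. 4.9 (proof: `K(1..4)`, `S(4) < 0.35`) [SalmhoferSeiler1991].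
-/

noncomputable section

namespace Summit.Ventures.YMGap.Conjectures

open Finset
open Literature.MathematicalPhysics.StatisticalMechanics
open Literature.Probability.LatticeModels (TorusSite)

/-! ### What a small-`β` extension needs, quantitatively: the `β = 0` margin, and semicontinuity of
the two constants at `β = 0⁺` uniformly in the volume -/

/-- **The `β = 0` margin of Cor. 4.9**: for `1 ≤ N ≤ 4` and `ν ≥ 4`, `2·(4N)·S(ν) < (2N)²/K(N)` — the
printed condition `2S(ν)K(N)/N < 1`, from `S(ν) < 0.35` (Prop. 4.2 (4), tree `fluctS_lt_of_four_le`) and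
`K(1), …, K(4) = 1, 2, 10/3, 83/15` (proof of Cor. 4.9, tree `sdK_uN_one` … `sdK_uN_four`). [cite: SalmhoferSeiler1991, Cor. 4.9 (proof) with Prop. 4.2 (4)] -/
theorem zeroCoupling_margin {N ν : ℕ} (hN1 : 1 ≤ N) (hN4 : N ≤ 4) (hν : 4 ≤ ν) :
    2 * (4 * N : ℝ) * ComplexSpin.fluctS ν < (2 * N : ℝ) ^ 2 / ComplexSpin.sdK N (ComplexSpin.uNLogCoeff N) := by
  have hS := ComplexSpin.fluctS_lt_of_four_le hν
  have hS0 := ComplexSpin.fluctS_nonneg ν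
  interval_cases N
  · rw [ComplexSpin.sdK_uN_one]; norm_num; linarith
  · rw [ComplexSpin.sdK_uN_two]; norm_num; linarith
  · rw [ComplexSpin.sdK_uN_three]; norm_num; linarith
  · rw [ComplexSpin.sdK_uN_four]; norm_num; linarith

/-- **WHAT AN EXTENSION TO SMALL `β > 0` NEEDS, QUANTITATIVELY.**  `SalmhoferSeilerSmallBeta` follows as
soon as, for every `1 ≤ N ≤ 4`, `ν ≥ 4` and every `ε > 0`, there are `β₁ > 0` and `L₀` such that for all
`0 ≤ β < β₁` and all even `L ≥ L₀` the conjecture's kernel `T_β = ssTwoPoint N ν L β 0` still obeys the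
`β = 0` bounds up to `ε`: the infrared bound (IR)_{β, 4N + ε} (row S3) and the Schwinger–Dyson bound
(SD)_{β, (2N)²/K(N) - ε} (row S4).  In words: upper semicontinuity at `β = 0⁺` of the infrared constant
and lower semicontinuity of the Schwinger–Dyson constant, BOTH UNIFORMLY IN THE VOLUME, and nothing else —
the `β = 0` margin `zeroCoupling_margin` absorbs `ε`.  (At each fixed `L` such `β₁(ε, L)` exist trivially,
the kernel being real-analytic in `β` — `StrongCouplingChiralLROAnalyticCoupling`; the uniformity in `L`
is the open content, not in print.) [cite: SalmhoferSeiler1991, Thm. 4.8 and Cor. 4.9 with (4.41)–(4.42)] -/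
theorem salmhoferSeilerSmallBeta_of_semicontinuous_bounds
    (h : ∀ N ν : ℕ, 1 ≤ N → N ≤ 4 → 4 ≤ ν → ∀ ε : ℝ, 0 < ε →
      ∃ β₁ : ℝ, 0 < β₁ ∧ ∃ L₀ : ℕ, ∀ β : ℝ, 0 ≤ β → β < β₁ → ∀ (L : ℕ) [NeZero L], Even L → L₀ ≤ L →
        (∀ χ : AddChar (TorusSite ν L) ℂ, -(ν : ℝ) < ComplexSpin.cosSum χ → ComplexSpin.cosSum χ < ν →
            2 * ((ν : ℝ) - ComplexSpin.cosSum χ) *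
                (ComplexSpin.kernelSymbol (fun x y => ssTwoPoint N ν L β 0 x y) χ).re ≤ 4 * N + ε ∧
              2 * ((ν : ℝ) + ComplexSpin.cosSum χ) *
                (-(ComplexSpin.kernelSymbol (fun x y => ssTwoPoint N ν L β 0 x y) χ).re) ≤ 4 * N + ε) ∧
          (2 * N : ℝ) ^ 2 / ComplexSpin.sdK N (ComplexSpin.uNLogCoeff N) - ε ≤
            ∑ μ : Fin ν, (ssTwoPoint N ν L β 0 0 (Pi.single μ 1) + ssTwoPoint N ν L β 0 0 (-Pi.single μ 1))) :
    SalmhoferSeilerSmallBeta := by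
  refine salmhoferSeilerSmallBeta_of_uniform_bounds fun N ν hN1 hN4 hν => ?_
  have hm := zeroCoupling_margin hN1 hN4 hν
  set b₀ : ℝ := (2 * N : ℝ) ^ 2 / ComplexSpin.sdK N (ComplexSpin.uNLogCoeff N) with hb₀
  set S : ℝ := ComplexSpin.fluctS ν with hS
  have hS0 : 0 ≤ S := ComplexSpin.fluctS_nonneg ν
  have hpos : 0 < 2 * S + 2 := by linarith
  -- the slack `ε` with `ε (2S + 2) = b₀ - 8NS`
  set ε : ℝ := (b₀ - 2 * (4 * N) * S) / (2 * S + 2) with hε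
  have hε0 : 0 < ε := div_pos (by linarith) hpos
  have hkey : ε * (2 * S + 2) = b₀ - 2 * (4 * N) * S := by
    rw [hε]
    field_simp
  obtain ⟨β₁, hβ₁, L₀, hL₀⟩ := h N ν hN1 hN4 hν ε hε0
  have hA : (0 : ℝ) ≤ 4 * N + ε := by
    have h4 : (0 : ℝ) ≤ 4 * N := by positivity
    linarith
  have hlt : 2 * (4 * N + ε) * S < b₀ - ε := by
    have h2 : 2 * (4 * N + ε) * S = b₀ - ε - ε := by
      rw [show 2 * (4 * N + ε) * S = 2 * (4 * N) * S + ε * (2 * S + 2) - 2 * ε by ring, hkey]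
      ring
    linarith
  exact ⟨β₁, hβ₁, 4 * N + ε, hA, b₀ - ε, hlt, L₀, hL₀⟩

/-! ### At each fixed volume the `ε`-semicontinuity holds (so only its volume-uniformity is open) -/

/-- **At each FIXED volume the hypothesis of `salmhoferSeilerSmallBeta_of_semicontinuous_bounds` holds**:
for `1 ≤ N ≤ 4`, an even torus `(ℤ/Lℤ)^ν` (`ν ≥ 1`) and `ε > 0` there is `β₁ > 0` — depending on `L` —
such that for all `0 ≤ β < β₁` the conjecture's kernel obeys (IR)_{β,4N+ε} and (SD)_{β,(2N)²/K(N)-ε}: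
the kernel is continuous in `β` (`continuous_ssTwoPoint_massless`), there are finitely many characters,
and at `β = 0` the bounds hold with `ε = 0` (`infraredBound_zero`, `schwingerDysonBound_zero`).  The
open content of Y3 is therefore exactly the UNIFORMITY of `β₁(ε, L)` in `L`. [cite: SalmhoferSeiler1991, Thm. 3.21 and Thm. 4.8 (4.38) (the `β = 0` bounds)] -/
theorem semicontinuous_bounds_fixedVolume (N ν L : ℕ) [NeZero ν] [NeZero L] (hN1 : 1 ≤ N) (hN4 : N ≤ 4)
    (hL : Even L) {ε : ℝ} (hε : 0 < ε) :
    ∃ β₁ : ℝ, 0 < β₁ ∧ ∀ β : ℝ, 0 ≤ β → β < β₁ →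
      (∀ χ : AddChar (TorusSite ν L) ℂ, -(ν : ℝ) < ComplexSpin.cosSum χ → ComplexSpin.cosSum χ < ν →
          2 * ((ν : ℝ) - ComplexSpin.cosSum χ) *
              (ComplexSpin.kernelSymbol (fun x y => ssTwoPoint N ν L β 0 x y) χ).re ≤ 4 * N + ε ∧
            2 * ((ν : ℝ) + ComplexSpin.cosSum χ) *
              (-(ComplexSpin.kernelSymbol (fun x y => ssTwoPoint N ν L β 0 x y) χ).re) ≤ 4 * N + ε) ∧
        (2 * N : ℝ) ^ 2 / ComplexSpin.sdK N (ComplexSpin.uNLogCoeff N) - ε ≤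
          ∑ μ : Fin ν, (ssTwoPoint N ν L β 0 0 (Pi.single μ 1) + ssTwoPoint N ν L β 0 0 (-Pi.single μ 1)) := by
  have hν1 : 1 ≤ ν := Nat.one_le_iff_ne_zero.mpr (NeZero.ne ν)
  have hT : ∀ z : TorusSite ν L, Continuous fun β : ℝ => ssTwoPoint N ν L β 0 0 z := fun z =>
    continuous_ssTwoPoint_massless N ν L hL 0 z
  have hK : ∀ χ : AddChar (TorusSite ν L) ℂ,
      Continuous fun β : ℝ => (ComplexSpin.kernelSymbol (fun x y => ssTwoPoint N ν L β 0 x y) χ).re := by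
    intro χ
    unfold ComplexSpin.kernelSymbol
    exact Complex.continuous_re.comp
      (continuous_finsetSum _ fun z _ => (Complex.continuous_ofReal.comp (hT z)).mul continuous_const)
  -- (IR) up to `ε`, eventually, for all characters at once (finitely many)
  have hIR : ∀ᶠ β in nhds (0 : ℝ), ∀ χ : AddChar (TorusSite ν L) ℂ,
      2 * ((ν : ℝ) - ComplexSpin.cosSum χ) *
          (ComplexSpin.kernelSymbol (fun x y => ssTwoPoint N ν L β 0 x y) χ).re < 4 * N + ε ∧
        2 * ((ν : ℝ) + ComplexSpin.cosSum χ) *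
          (-(ComplexSpin.kernelSymbol (fun x y => ssTwoPoint N ν L β 0 x y) χ).re) < 4 * N + ε := by
    refine Filter.eventually_all.2 fun χ => ?_
    obtain ⟨h1, h2⟩ := infraredBound_zero hN1 hN4 hν1 hL χ
    have hc1 : Continuous fun β : ℝ => 2 * ((ν : ℝ) - ComplexSpin.cosSum χ) *
        (ComplexSpin.kernelSymbol (fun x y => ssTwoPoint N ν L β 0 x y) χ).re :=
      continuous_const.mul (hK χ)
    have hc2 : Continuous fun β : ℝ => 2 * ((ν : ℝ) + ComplexSpin.cosSum χ) *
        (-(ComplexSpin.kernelSymbol (fun x y => ssTwoPoint N ν L β 0 x y) χ).re) :=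
      continuous_const.mul (hK χ).neg
    refine (hc1.continuousAt.eventually_lt continuousAt_const ?_).and
      (hc2.continuousAt.eventually_lt continuousAt_const ?_)
    · show 2 * ((ν : ℝ) - ComplexSpin.cosSum χ) *
          (ComplexSpin.kernelSymbol (fun x y => ssTwoPoint N ν L 0 0 x y) χ).re < 4 * N + ε
      linarith
    · show 2 * ((ν : ℝ) + ComplexSpin.cosSum χ) *
          (-(ComplexSpin.kernelSymbol (fun x y => ssTwoPoint N ν L 0 0 x y) χ).re) < 4 * N + ε
      linarith
  -- (SD) up to `ε`, eventually
  have hSD : ∀ᶠ β in nhds (0 : ℝ), (2 * N : ℝ) ^ 2 / ComplexSpin.sdK N (ComplexSpin.uNLogCoeff N) - ε <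
      ∑ μ : Fin ν, (ssTwoPoint N ν L β 0 0 (Pi.single μ 1) + ssTwoPoint N ν L β 0 0 (-Pi.single μ 1)) := by
    have h0 := schwingerDysonBound_zero hN1 hN4 hν1 hL
    have hs : Continuous fun β : ℝ =>
        ∑ μ : Fin ν, (ssTwoPoint N ν L β 0 0 (Pi.single μ 1) + ssTwoPoint N ν L β 0 0 (-Pi.single μ 1)) :=
      continuous_finsetSum _ fun μ _ => (hT _).add (hT _)
    refine continuousAt_const.eventually_lt hs.continuousAt ?_
    show (2 * N : ℝ) ^ 2 / ComplexSpin.sdK N (ComplexSpin.uNLogCoeff N) - ε <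
      ∑ μ : Fin ν, (ssTwoPoint N ν L 0 0 0 (Pi.single μ 1) + ssTwoPoint N ν L 0 0 0 (-Pi.single μ 1))
    linarith
  obtain ⟨δ, hδ, hball⟩ := Metric.eventually_nhds_iff.1 (hIR.and hSD)
  refine ⟨δ, hδ, fun β hβ hβδ => ?_⟩
  have hd : dist β 0 < δ := by rwa [Real.dist_eq, sub_zero, abs_of_nonneg hβ]
  obtain ⟨hI, hS⟩ := hball hd
  exact ⟨fun χ _ _ => ⟨(hI χ).1.le, (hI χ).2.le⟩, hS.le⟩

end Summit.Ventures.YMGap.Conjectures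

end
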